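import Literature.NumberTheory.Rogawski1990.ArchCanonicalTransferFactor
import Literature.NumberTheory.Rogawski1990.ArchExplicitTransferFactorRegular
import HarnessLib

/-!
# `Δ″_∞ ≠ 0` on the matching `G`-regular pairs: Rogawski's explicit archimedean transfer factor is NON-DEGENERATE (node N2∞ of `F0/P3a/T6b-TREE.md`)

Topic `NumberTheory/Rogawski1990`; namespace `Literature.NumberTheory.Rogawski1990`.  THEOREMS ONLY (no `def` ∕ fact ∕ `sorry` ∕ instance ∕ notation);
imports ★ `ArchCanonicalTransferFactor` (typ-T6b; hence ★ `…ConjRight`) and ★ `ArchExplicitTransferFactorRegular` (B-p12; part 1: `χ_{g_w}(γ₂,w) ≠ 0`,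
`τ ≠ 0`, `D ≠ 0`).  Cell `pub/hodgecm-mathlib`, F0∕P3a, topic T6, seat B-p12 (g25).  HONEST LABEL: HC_CM is proved only modulo the printed citations («named
inputs remaining 2») until rung 0 closes; this file proves nothing of them — it discharges conjunct (iv) «non-degeneracy» of ★ #77 at PRINT'S FACTOR,
`IsArchNondegenerate L H′ (archExplicitTransferFactor L H′ μ hl hr)`, for a `c`-hermitian anisotropic `H′`, with no hypothesis on `μ` (its values are units).

THE MATHEMATICS (Rogawski 1990 §4.9 pp. 54–55 «`|Δ_{G∕H}| = D_{G∕H}`»; §14.6 p. 242 «`κ(γ, ψ_v(iγ))` is equal to `±1`»): on a matching pair `ι(γ_H) ↔ γ′`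
with `γ_H = (g, γ₂)` `G`-regular, `Δ″_∞ = τ(γ_H) · D_{G∕H,∞}(γ_H) · Π_w κ_w(γ_H, γ′)` and each factor is non-zero:
* part 1 (`ArchExplicitTransferFactorRegular`): `G`-regular ⇒ **`χ_{g_w}(γ₂,w) ≠ 0`** at every complex place, `τ ≠ 0`, `D_{G∕H,∞} ≠ 0`, `|γ₂,w| = 1`.
* §2 `κ_w ≠ 0`: by ★ `Corresponds` there is `c ∈ GL₃(L ⊗ ℝ)` with `γ′ = c ι(γ_H) c⁻¹`, and `P_w = χ_{g_w}(γ′_w) = v · (s qᵀ)` with `v = c_w e₂` (the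
  `γ₂`-eigenvector of `γ′_w`), `q = e₂ᵀ c_w⁻¹ ≠ 0`, `s = χ_{g_w}(γ₂,w) ≠ 0` (`archEigenlineProjector_eq_vecMulVec_of_conj_eq`); hence
  `Re tr(P_wᴴ H P_w) = |s|²‖q‖² · Re(vᴴ H v)` with `H = w(H′)` hermitian (so `vᴴ H v ∈ ℝ`) and **`vᴴ H v ≠ 0`** by the eigenline argument, WITHOUT
  diagonalising: `γ′_wᴴ H γ′_w = H` (★ `conjTranspose_map_evalC_mul_form_mul`), `γ′_w v = γ₂,w v`, `|γ₂,w| = 1` give `vᴴ H γ′_w = γ₂,w · vᴴ H`, so the row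
  `r := vᴴ H c_w` is a left `γ₂,w`-eigenvector of the pattern `ι_w`, so `(r₀, r₂)` is a left `γ₂,w`-eigenvector of `g_w` or zero, and `χ_{g_w}(γ₂,w) ≠ 0`
  forces `r₀ = r₂ = 0`; were also `r₁ = vᴴ H v = 0`, then `vᴴ H = 0` with `v ≠ 0`, contradicting `det w(H′) ≠ 0` (anisotropy).
* §3 assembly: `isArchNondegenerate_archExplicitTransferFactor` (typ-T6a's stub text token for token) and, for typ-T6b's canonical factor
  `Δ‴_∞ = c(H′)·Δ″_∞` (★ `archCanonicalTransferFactor`, `c(H′) = ±1`), `isArchNondegenerate_archCanonicalTransferFactor`.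

## References
* [Rogawski1990] J. D. Rogawski, *Automorphic Representations of Unitary Groups in Three Variables*, Ann. of Math. Stud. 123 (1990): §4.3 p. 42,
  §4.9 pp. 54–55 (`D_G`, `Δ_{G∕H} = τ D_{G∕H}`, `|τ| = 1`), §14.6 p. 242 (`κ = ±1`), §3.6 pp. 28–29 (eigenlines of regular elements of `U(2,1)(ℝ)`).
* [LanglandsShelstad1987] R. P. Langlands, D. Shelstad, *On the definition of transfer factors*, Math. Ann. 278 (1987), §1 (`G`-regular pairs).
* [PlatonovRapinchuk1994] V. Platonov, A. Rapinchuk, *Algebraic Groups and Number Theory*, Academic Press (1994), §2.3 (unitary groups of hermitian forms).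
-/

set_option autoImplicit false

noncomputable section

open NumberField NumberField.InfinitePlace Matrix Polynomial
open Literature.NumberTheory.GaloisRepresentations
open Literature.AlgebraicGeometry.ShimuraVarieties (hermForm)
open scoped MatrixGroups ComplexOrder

namespace Literature.NumberTheory.Rogawski1990

open Literature.NumberTheory.Automorphic

/-! ## §1 Matrix algebra over `ℂ` (private plumbing) -/

section Algebra

variable {n : Type*} [Fintype n]

/-- `r̄ · r = Σ_i |r_i|²` (as a real number). [folklore] -/
private theorem star_dotProduct_self_eq_ofReal (r : n → ℂ) :
    star r ⬝ᵥ r = ((∑ i, Complex.normSq (r i) : ℝ) : ℂ) := by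
  rw [Complex.ofReal_sum]
  simp only [dotProduct, Pi.star_apply, Complex.star_def, Complex.normSq_eq_conj_mul_self]

/-- `Σ |r_i|² = 0 ↔ r = 0`. [folklore] -/
private theorem sum_normSq_eq_zero_iff (r : n → ℂ) : (∑ i, Complex.normSq (r i)) = 0 ↔ r = 0 := by
  rw [← Complex.ofReal_eq_zero, ← star_dotProduct_self_eq_ofReal, dotProduct_star_self_eq_zero]

/-- **Trace of a rank-one hermitian congruence**: `tr((p qᵀ)ᴴ H (p qᵀ)) = (q^† q) · (p^† H p)`. [folklore] -/
private theorem trace_conjTranspose_vecMulVec_mul_mul (p q : n → ℂ) (H : Matrix n n ℂ) :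
    ((vecMulVec p q)ᴴ * H * vecMulVec p q).trace = (star q ⬝ᵥ q) * (star p ⬝ᵥ H *ᵥ p) := by
  rw [conjTranspose_vecMulVec, vecMulVec_mul, vecMulVec_mul_vecMulVec, trace_vecMulVec, dotProduct_smul, ← dotProduct_mulVec,
    smul_eq_mul, mul_comm]

/-- **The pattern `ι(g, u) = (g₀₀ 0 g₀₁; 0 u 0; g₁₀ 0 g₁₁)` is killed by `χ_g` off the middle entry** (Cayley–Hamilton for the `2 × 2` block):
`ι² − tr(g)·ι + det(g)·1 = χ_g(u) · E₂₂`. [folklore] -/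
private theorem endoPattern_sq_sub_trace_smul_add_det_smul_one (g : Matrix (Fin 2) (Fin 2) ℂ) (u : ℂ) :
    (!![g 0 0, 0, g 0 1; 0, u, 0; g 1 0, 0, g 1 1] * !![g 0 0, 0, g 0 1; 0, u, 0; g 1 0, 0, g 1 1] -
        g.trace • !![g 0 0, 0, g 0 1; 0, u, 0; g 1 0, 0, g 1 1] + g.det • (1 : Matrix (Fin 3) (Fin 3) ℂ)) =
      vecMulVec (Pi.single 1 (u * u - g.trace * u + g.det)) (Pi.single 1 1) := by
  ext i j
  rw [Matrix.trace_fin_two, Matrix.det_fin_two]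
  fin_cases i <;> fin_cases j <;>
    simp [vecMulVec_apply] <;> ring

/-- Conjugating a quadratic polynomial in a matrix: `(cιc′)² − t·(cιc′) + d = c (ι² − tι + d) c′` when `c′c = 1 = cc′`. [folklore] -/
private theorem conj_mul_sq_sub_smul_add_smul_one {m : Type*} [Fintype m] [DecidableEq m] (c c' ι : Matrix m m ℂ) (t d : ℂ)
    (h1 : c' * c = 1) (h2 : c * c' = 1) :
    c * ι * c' * (c * ι * c') - t • (c * ι * c') + d • (1 : Matrix m m ℂ) = c * (ι * ι - t • ι + d • 1) * c' := by
  have hsq : c * ι * c' * (c * ι * c') = c * (ι * ι) * c' := by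
    calc c * ι * c' * (c * ι * c') = c * ι * (c' * c) * ι * c' := by simp only [Matrix.mul_assoc]
      _ = c * (ι * ι) * c' := by rw [h1, Matrix.mul_one, Matrix.mul_assoc c ι ι]
  rw [hsq]
  simp only [Matrix.mul_sub, Matrix.mul_add, Matrix.sub_mul, Matrix.add_mul, Matrix.mul_smul, Matrix.smul_mul, Matrix.mul_one, h2]

/-- `(c e₂ s)(e₂ᵀ c′) = (c e₂)(s e₂ᵀ c′)` written with explicit coordinates. [folklore] -/
private theorem vecMulVec_mulVec_single_eq (c c' : Matrix (Fin 3) (Fin 3) ℂ) (s : ℂ) :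
    vecMulVec (c *ᵥ Pi.single 1 s) (Pi.single 1 1 ᵥ* c') = vecMulVec (fun i => c i 1) (fun j => s * c' 1 j) := by
  ext i j
  simp [vecMulVec_apply]
  ring

/-- The sign of a non-zero real, cast to `ℤ`, is non-zero. [folklore] -/
private theorem intCast_sign_ne_zero {x : ℝ} (hx : x ≠ 0) : ((SignType.sign x : SignType) : ℤ) ≠ 0 := by
  rcases lt_trichotomy x 0 with h | h | h
  · rw [sign_neg h]; decide
  · exact absurd h hx
  · rw [sign_pos h]; decide

end Algebra

/-! ## §2 The explicit rank-one form of `P_w` on a matching pair, the eigenline argument, `κ_w ≠ 0` -/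

section Place

variable (L : Type) [Field L] [NumberField L] [IsCMField L] (H' : Matrix (Fin 3) (Fin 3) L)
  (a : ↥(UnitaryGroup.arch (↥(maximalRealSubfield L)) L (IsCMField.complexConj L) 2
      (Matrix.of fun i j : Fin 2 => if i.val + j.val + 1 = 2 then (1 : L) else 0)) ×
    ↥(UnitaryGroup.arch (↥(maximalRealSubfield L)) L (IsCMField.complexConj L) 1
      (Matrix.of fun i j : Fin 1 => if i.val + j.val + 1 = 1 then (1 : L) else 0)))
  (b : ↥(UnitaryGroup.arch (↥(maximalRealSubfield L)) L (IsCMField.complexConj L) 3 H'))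
  (w : {w : InfinitePlace L // IsComplex w})

/-- **`P_w(γ_H, γ′) = (c_w e₂) · (χ_{g_w}(γ₂,w) e₂ᵀ c_w⁻¹)`** when `γ′ = c ι(γ_H) c⁻¹` in `GL₃(L ⊗ ℝ)` — the coordinate form of ★
`archEigenlineProjector_eq_vecMulVec_of_isArchNormPair` (Cayley–Hamilton on the `g_w`-block of the pattern `ι`). [cite: Rogawski1990, §14.6 p. 242; §4.9 p. 55] -/
theorem archEigenlineProjector_eq_vecMulVec_of_conj_eq (c : GL (Fin 3) (mixedEmbedding.mixedSpace L))
    (hc : c * ((endoEmbArch L a : ↥(UnitaryGroup.arch (↥(maximalRealSubfield L)) L (IsCMField.complexConj L) 3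
            (Matrix.of fun i j : Fin 3 => if i.val + j.val + 1 = 3 then (1 : L) else 0))) :
            GL (Fin 3) (mixedEmbedding.mixedSpace L)) * c⁻¹ = (b : GL (Fin 3) (mixedEmbedding.mixedSpace L))) :
    archEigenlineProjector L H' a w b =
      vecMulVec (fun i => UnitaryGroup.evalC L w ((c : Matrix (Fin 3) (Fin 3) (mixedEmbedding.mixedSpace L)) i 1))
        (fun j => UnitaryGroup.evalC L w ((archCharpolyTwo L a).eval (archGammaTwo L a)) *
          UnitaryGroup.evalC L w (((c⁻¹ : GL (Fin 3) (mixedEmbedding.mixedSpace L)) : Matrix (Fin 3) (Fin 3) (mixedEmbedding.mixedSpace L)) 1 j)) := by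
  have hmat : ((b : GL (Fin 3) (mixedEmbedding.mixedSpace L)) : Matrix (Fin 3) (Fin 3) (mixedEmbedding.mixedSpace L)) =
      (c : Matrix (Fin 3) (Fin 3) (mixedEmbedding.mixedSpace L)) *
        (((endoEmbArch L a : ↥(UnitaryGroup.arch (↥(maximalRealSubfield L)) L (IsCMField.complexConj L) 3
            (Matrix.of fun i j : Fin 3 => if i.val + j.val + 1 = 3 then (1 : L) else 0))) :
            GL (Fin 3) (mixedEmbedding.mixedSpace L)) : Matrix (Fin 3) (Fin 3) (mixedEmbedding.mixedSpace L)) *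
        ((c⁻¹ : GL (Fin 3) (mixedEmbedding.mixedSpace L)) : Matrix (Fin 3) (Fin 3) (mixedEmbedding.mixedSpace L)) := by
    rw [← Units.val_mul, ← Units.val_mul, hc]
  set cw := (c : Matrix (Fin 3) (Fin 3) (mixedEmbedding.mixedSpace L)).map (UnitaryGroup.evalC L w) with hcw
  set cw' := ((c⁻¹ : GL (Fin 3) (mixedEmbedding.mixedSpace L)) : Matrix (Fin 3) (Fin 3) (mixedEmbedding.mixedSpace L)).map
    (UnitaryGroup.evalC L w) with hcw'
  have h1 : cw' * cw = 1 := by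
    rw [hcw, hcw', ← Matrix.map_mul, ← Units.val_mul, inv_mul_cancel, Units.val_one,
      Matrix.map_one _ (map_zero (UnitaryGroup.evalC L w)) (map_one (UnitaryGroup.evalC L w))]
  have h2 : cw * cw' = 1 := by
    rw [hcw, hcw', ← Matrix.map_mul, ← Units.val_mul, mul_inv_cancel, Units.val_one,
      Matrix.map_one _ (map_zero (UnitaryGroup.evalC L w)) (map_one (UnitaryGroup.evalC L w))]
  set g := (((a.1 : ↥(UnitaryGroup.arch (↥(maximalRealSubfield L)) L (IsCMField.complexConj L) 2
      (Matrix.of fun i j : Fin 2 => if i.val + j.val + 1 = 2 then (1 : L) else 0))) :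
        GL (Fin 2) (mixedEmbedding.mixedSpace L)) : Matrix (Fin 2) (Fin 2) (mixedEmbedding.mixedSpace L)) with hg
  set u := (((a.2 : ↥(UnitaryGroup.arch (↥(maximalRealSubfield L)) L (IsCMField.complexConj L) 1
      (Matrix.of fun i j : Fin 1 => if i.val + j.val + 1 = 1 then (1 : L) else 0))) :
        GL (Fin 1) (mixedEmbedding.mixedSpace L)) : Matrix (Fin 1) (Fin 1) (mixedEmbedding.mixedSpace L)) with hu
  have hι : ((((endoEmbArch L a : ↥(UnitaryGroup.arch (↥(maximalRealSubfield L)) L (IsCMField.complexConj L) 3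
            (Matrix.of fun i j : Fin 3 => if i.val + j.val + 1 = 3 then (1 : L) else 0))) :
            GL (Fin 3) (mixedEmbedding.mixedSpace L)) : Matrix (Fin 3) (Fin 3) (mixedEmbedding.mixedSpace L))).map
          (UnitaryGroup.evalC L w) =
      !![(g.map (UnitaryGroup.evalC L w)) 0 0, 0, (g.map (UnitaryGroup.evalC L w)) 0 1;
        0, UnitaryGroup.evalC L w (u 0 0), 0;
        (g.map (UnitaryGroup.evalC L w)) 1 0, 0, (g.map (UnitaryGroup.evalC L w)) 1 1] := by
    rw [coe_endoEmbArch, coe_endoGL_eq]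
    ext i j
    fin_cases i <;> fin_cases j <;> simp [Matrix.map_apply, hg, hu]
  have hs : UnitaryGroup.evalC L w ((archCharpolyTwo L a).eval (archGammaTwo L a)) =
      UnitaryGroup.evalC L w (u 0 0) * UnitaryGroup.evalC L w (u 0 0) -
        (g.map (UnitaryGroup.evalC L w)).trace * UnitaryGroup.evalC L w (u 0 0) + (g.map (UnitaryGroup.evalC L w)).det :=
    evalC_eval_archCharpolyTwo_archGammaTwo L a w
  rw [hs]
  dsimp only [archEigenlineProjector]
  rw [← hg, hmat, Matrix.map_mul, Matrix.map_mul, hι, ← hcw, ← hcw', conj_mul_sq_sub_smul_add_smul_one cw cw' _ _ _ h1 h2,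
    endoPattern_sq_sub_trace_smul_add_det_smul_one (g.map (UnitaryGroup.evalC L w)) (UnitaryGroup.evalC L w (u 0 0)),
    mul_vecMulVec, vecMulVec_mul, vecMulVec_mulVec_single_eq]
  rfl

/-- **The distinguished eigenline is not `w(H′)`-isotropic**: for `γ′ = c ι(γ_H) c⁻¹` with `γ_H` `G`-regular and `H′` anisotropic (`det H′ ≠ 0`),
`vᴴ · w(H′) · v ≠ 0` for `v = c_w e₂` (the `γ₂,w`-eigenvector of `γ′_w`) — by unitarity of `γ′_w`, `vᴴ w(H′) c_w` is a left `γ₂,w`-eigenvector of the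
pattern `ι_w`, whose outer coordinates vanish since `χ_{g_w}(γ₂,w) ≠ 0`; so `vᴴ w(H′) v = 0` would force `vᴴ w(H′) = 0`, contradicting `det w(H′) ≠ 0`.
[cite: Rogawski1990, §3.6 pp. 28–29; §14.6 p. 242] -/
theorem star_dotProduct_form_mulVec_ne_zero_of_conj_eq
    (hanis : ∀ x : Fin 3 → L, hermForm (cmConjRingHom L) H' x x = 0 → x = 0) (hreg : IsArchGRegular L a)
    (c : GL (Fin 3) (mixedEmbedding.mixedSpace L))
    (hc : c * ((endoEmbArch L a : ↥(UnitaryGroup.arch (↥(maximalRealSubfield L)) L (IsCMField.complexConj L) 3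
            (Matrix.of fun i j : Fin 3 => if i.val + j.val + 1 = 3 then (1 : L) else 0))) :
            GL (Fin 3) (mixedEmbedding.mixedSpace L)) * c⁻¹ = (b : GL (Fin 3) (mixedEmbedding.mixedSpace L))) :
    star (fun i => UnitaryGroup.evalC L w ((c : Matrix (Fin 3) (Fin 3) (mixedEmbedding.mixedSpace L)) i 1)) ⬝ᵥ
        H'.map w.1.embedding *ᵥ (fun i => UnitaryGroup.evalC L w ((c : Matrix (Fin 3) (Fin 3) (mixedEmbedding.mixedSpace L)) i 1)) ≠ 0 := by
  -- notation
  set φ := UnitaryGroup.evalC L w with hφ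
  set H := H'.map w.1.embedding with hH
  set cw := (c : Matrix (Fin 3) (Fin 3) (mixedEmbedding.mixedSpace L)).map φ with hcw
  set cw' := ((c⁻¹ : GL (Fin 3) (mixedEmbedding.mixedSpace L)) : Matrix (Fin 3) (Fin 3) (mixedEmbedding.mixedSpace L)).map φ with hcw'
  set bw := ((b : GL (Fin 3) (mixedEmbedding.mixedSpace L)) : Matrix (Fin 3) (Fin 3) (mixedEmbedding.mixedSpace L)).map φ with hbw
  set g := (((a.1 : ↥(UnitaryGroup.arch (↥(maximalRealSubfield L)) L (IsCMField.complexConj L) 2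
      (Matrix.of fun i j : Fin 2 => if i.val + j.val + 1 = 2 then (1 : L) else 0))) :
        GL (Fin 2) (mixedEmbedding.mixedSpace L)) : Matrix (Fin 2) (Fin 2) (mixedEmbedding.mixedSpace L)) with hg
  set u := (((a.2 : ↥(UnitaryGroup.arch (↥(maximalRealSubfield L)) L (IsCMField.complexConj L) 1
      (Matrix.of fun i j : Fin 1 => if i.val + j.val + 1 = 1 then (1 : L) else 0))) :
        GL (Fin 1) (mixedEmbedding.mixedSpace L)) : Matrix (Fin 1) (Fin 1) (mixedEmbedding.mixedSpace L)) with hu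
  set gw := g.map φ with hgw
  set uw := φ (u 0 0) with huw
  set v : Fin 3 → ℂ := fun i => UnitaryGroup.evalC L w ((c : Matrix (Fin 3) (Fin 3) (mixedEmbedding.mixedSpace L)) i 1) with hv
  have hvcw : v = fun i => cw i 1 := rfl
  -- invertibility of `c_w`
  have h1 : cw' * cw = 1 := by
    rw [hcw, hcw', ← Matrix.map_mul, ← Units.val_mul, inv_mul_cancel, Units.val_one, Matrix.map_one _ (map_zero φ) (map_one φ)]
  have h2 : cw * cw' = 1 := by
    rw [hcw, hcw', ← Matrix.map_mul, ← Units.val_mul, mul_inv_cancel, Units.val_one, Matrix.map_one _ (map_zero φ) (map_one φ)]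
  -- `γ′_w = c_w ι_w c_w⁻¹` with the explicit pattern
  set ιw : Matrix (Fin 3) (Fin 3) ℂ := !![gw 0 0, 0, gw 0 1; 0, uw, 0; gw 1 0, 0, gw 1 1] with hιw
  have hι : ((((endoEmbArch L a : ↥(UnitaryGroup.arch (↥(maximalRealSubfield L)) L (IsCMField.complexConj L) 3
            (Matrix.of fun i j : Fin 3 => if i.val + j.val + 1 = 3 then (1 : L) else 0))) :
            GL (Fin 3) (mixedEmbedding.mixedSpace L)) : Matrix (Fin 3) (Fin 3) (mixedEmbedding.mixedSpace L))).map φ = ιw := by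
    rw [coe_endoEmbArch, coe_endoGL_eq, hιw]
    ext i j
    fin_cases i <;> fin_cases j <;> simp [Matrix.map_apply, hgw, huw, hg, hu]
  have hbw' : bw = cw * ιw * cw' := by
    rw [hbw, ← hι, hcw, hcw', ← Matrix.map_mul, ← Matrix.map_mul, ← Units.val_mul, ← Units.val_mul, hc]
  have hbc : bw * cw = cw * ιw := by rw [hbw', Matrix.mul_assoc, h1, Matrix.mul_one]
  -- `v` is the `γ₂,w`-eigenvector of `γ′_w`
  have hιe : ιw *ᵥ (Pi.single 1 (1 : ℂ)) = uw • Pi.single 1 (1 : ℂ) := by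
    ext i
    fin_cases i <;> simp [hιw, Matrix.mulVec, dotProduct, Fin.sum_univ_three]
  have hve : cw *ᵥ Pi.single 1 (1 : ℂ) = v := by
    rw [Matrix.mulVec_single_one]
    rfl
  have hbv : bw *ᵥ v = uw • v := by
    rw [← hve, Matrix.mulVec_mulVec, hbc, ← Matrix.mulVec_mulVec, hιe, Matrix.mulVec_smul]
  -- unitarity of `γ′_w` and `|γ₂,w| = 1`
  have hb : bwᴴ * H * bw = H := conjTranspose_map_evalC_mul_form_mul L H' b w
  have hu1 : starRingEnd ℂ uw * uw = 1 := star_evalC_archGammaTwo_mul_self L a w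
  have hu1' : uw * star uw = 1 := by rw [Complex.star_def, mul_comm]; exact hu1
  -- Step A: `vᴴ H γ′_w = γ₂,w · vᴴ H`
  have hA : star v ᵥ* (H * bw) = uw • (star v ᵥ* H) := by
    have e1 : star v ᵥ* H = star v ᵥ* (bwᴴ * H * bw) := by rw [hb]
    rw [← Matrix.vecMul_vecMul, ← Matrix.vecMul_vecMul, ← Matrix.star_mulVec, hbv, star_smul, Matrix.smul_vecMul,
      Matrix.smul_vecMul, Matrix.vecMul_vecMul] at e1
    rw [e1, smul_smul, hu1', one_smul]
  -- Step B: `r := vᴴ H c_w` is a left `γ₂,w`-eigenvector of the pattern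
  set r : Fin 3 → ℂ := star v ᵥ* H ᵥ* cw with hr
  have hB : r ᵥ* ιw = uw • r := by
    rw [hr, Matrix.vecMul_vecMul, ← hbc, ← Matrix.vecMul_vecMul, Matrix.vecMul_vecMul (star v) H bw, hA, Matrix.smul_vecMul]
  -- Step C: the outer coordinates of `r` vanish
  have hB0 : r 0 * gw 0 0 + r 2 * gw 1 0 = uw * r 0 := by
    have := congrFun hB 0
    simpa [hιw, Matrix.vecMul, dotProduct, Fin.sum_univ_three] using this
  have hB2 : r 0 * gw 0 1 + r 2 * gw 1 1 = uw * r 2 := by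
    have := congrFun hB 2
    simpa [hιw, Matrix.vecMul, dotProduct, Fin.sum_univ_three] using this
  have hs : uw * uw - gw.trace * uw + gw.det ≠ 0 := by
    have h := evalC_eval_archCharpolyTwo_ne_zero_of_isArchGRegular L a w hreg
    rw [evalC_eval_archCharpolyTwo_archGammaTwo] at h
    exact h
  rw [Matrix.trace_fin_two, Matrix.det_fin_two] at hs
  have hr0 : r 0 = 0 := by
    have h : (uw * uw - (gw 0 0 + gw 1 1) * uw + (gw 0 0 * gw 1 1 - gw 0 1 * gw 1 0)) * r 0 = 0 := by
      linear_combination (gw 1 1 - uw) * hB0 - gw 1 0 * hB2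
    exact (mul_eq_zero.1 h).resolve_left hs
  have hr2 : r 2 = 0 := by
    have h : (uw * uw - (gw 0 0 + gw 1 1) * uw + (gw 0 0 * gw 1 1 - gw 0 1 * gw 1 0)) * r 2 = 0 := by
      linear_combination (gw 0 0 - uw) * hB2 - gw 0 1 * hB0
    exact (mul_eq_zero.1 h).resolve_left hs
  -- Step D: `r₁ = vᴴ H v`
  have hr1 : r 1 = star v ⬝ᵥ H *ᵥ v := by
    rw [Matrix.dotProduct_mulVec]
    rfl
  -- Step E: `vᴴ H v = 0` would give `vᴴ H = 0`, contradicting `det w(H′) ≠ 0` and `v ≠ 0`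
  intro hz
  have hr_zero : r = 0 := by
    funext i
    fin_cases i
    · exact hr0
    · exact hr1.trans hz
    · exact hr2
  have hvH : star v ᵥ* H = 0 := by
    have : star v ᵥ* H = r ᵥ* cw' := by
      rw [hr, Matrix.vecMul_vecMul, Matrix.vecMul_vecMul, h2, Matrix.mul_one]
    rw [this, hr_zero, Matrix.zero_vecMul]
  have hdetH' : H'.det ≠ 0 := by
    intro hdet
    obtain ⟨x, hx, hHx⟩ := Matrix.exists_mulVec_eq_zero_iff.mpr hdet
    refine hx (hanis x ?_)
    unfold hermForm
    rw [hHx, dotProduct_zero]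
  have hdetH : H.det ≠ 0 := by
    rw [hH, ← RingHom.mapMatrix_apply, ← RingHom.map_det]
    exact (_root_.map_ne_zero _).2 hdetH'
  have hv0 : v ≠ 0 := by
    intro hv0
    have h11 := congrFun (congrFun h1 1) 1
    rw [Matrix.mul_apply, Matrix.one_apply_eq] at h11
    have hcol : ∀ j, cw j 1 = 0 := fun j => by
      have := congrFun hv0 j
      simpa [hvcw] using this
    simp [hcol] at h11
  have hsv0 : star v ≠ 0 := fun h => hv0 (star_eq_zero.1 h)
  exact hdetH (Matrix.exists_vecMul_eq_zero_iff.1 ⟨star v, hsv0, hvH⟩)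

/-- **`κ_w(γ_H, γ′) ≠ 0` on a matching `G`-regular pair** for `c`-hermitian anisotropic `H′` («`κ(γ, ψ_v(iγ)) = ±1`»): `Re tr(P_wᴴ w(H′) P_w) =
|χ_{g_w}(γ₂,w)|² · ‖e₂ᵀ c_w⁻¹‖² · vᴴ w(H′) v ≠ 0`. [cite: Rogawski1990, §14.6 p. 242; §4.9 p. 55] -/
theorem archKappaAt_ne_zero (hherm : (H'.map (cmConjRingHom L)).transpose = H')
    (hanis : ∀ x : Fin 3 → L, hermForm (cmConjRingHom L) H' x x = 0 → x = 0) (hp : IsArchNormPair L H' a b) (hreg : IsArchGRegular L a) :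
    archKappaAt L H' a w b ≠ 0 := by
  have hp' := hp
  rw [isArchNormPair_iff] at hp'
  obtain ⟨c, hc⟩ := isConj_iff.1 hp'
  set φ := UnitaryGroup.evalC L w with hφ
  set H := H'.map w.1.embedding with hH
  set v : Fin 3 → ℂ := fun i => φ ((c : Matrix (Fin 3) (Fin 3) (mixedEmbedding.mixedSpace L)) i 1) with hv
  set s : ℂ := φ ((archCharpolyTwo L a).eval (archGammaTwo L a)) with hsdef
  set q : Fin 3 → ℂ := fun j => s * φ (((c⁻¹ : GL (Fin 3) (mixedEmbedding.mixedSpace L)) : Matrix (Fin 3) (Fin 3) (mixedEmbedding.mixedSpace L)) 1 j)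
    with hq
  have hP : archEigenlineProjector L H' a w b = vecMulVec v q := archEigenlineProjector_eq_vecMulVec_of_conj_eq L H' a b w c hc
  have hs : s ≠ 0 := evalC_eval_archCharpolyTwo_ne_zero_of_isArchGRegular L a w hreg
  -- `z = vᴴ H v` is real and non-zero
  have hz : star v ⬝ᵥ H *ᵥ v ≠ 0 := star_dotProduct_form_mulVec_ne_zero_of_conj_eq L H' a b w hanis hreg c hc
  have hHh : Hᴴ = H := by
    have hcomp : (star : ℂ → ℂ) ∘ (w.1.embedding : L → ℂ) = (w.1.embedding : L → ℂ) ∘ (cmConjRingHom L : L → L) := by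
      funext x
      simp only [Function.comp_apply, embedding_cmConjRingHom, Complex.star_def]
    rw [hH, Matrix.conjTranspose, Matrix.transpose_map, Matrix.map_map, hcomp, ← Matrix.map_map, ← Matrix.transpose_map, hherm]
  have hzz : star (star v ⬝ᵥ H *ᵥ v) = star v ⬝ᵥ H *ᵥ v := by
    rw [← Matrix.star_dotProduct_star, star_star, Matrix.star_mulVec, hHh, ← Matrix.dotProduct_mulVec]
  have hzre : ((star v ⬝ᵥ H *ᵥ v).re : ℂ) = star v ⬝ᵥ H *ᵥ v := Complex.conj_eq_iff_re.1 (by rw [← Complex.star_def]; exact hzz)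
  have hzre0 : (star v ⬝ᵥ H *ᵥ v).re ≠ 0 := by
    intro h0
    apply hz
    rw [← hzre, h0, Complex.ofReal_zero]
  -- `q ≠ 0`: a row of the invertible `c_w⁻¹`, scaled by `s ≠ 0`
  have hq0 : q ≠ 0 := by
    set cw := (c : Matrix (Fin 3) (Fin 3) (mixedEmbedding.mixedSpace L)).map φ with hcw
    set cw' := ((c⁻¹ : GL (Fin 3) (mixedEmbedding.mixedSpace L)) : Matrix (Fin 3) (Fin 3) (mixedEmbedding.mixedSpace L)).map φ with hcw'
    have h1 : cw' * cw = 1 := by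
      rw [hcw, hcw', ← Matrix.map_mul, ← Units.val_mul, inv_mul_cancel, Units.val_one, Matrix.map_one _ (map_zero φ) (map_one φ)]
    intro hq0
    have h11 := congrFun (congrFun h1 1) 1
    rw [Matrix.mul_apply, Matrix.one_apply_eq] at h11
    have hrow : ∀ j, cw' 1 j = 0 := fun j => by
      have := congrFun hq0 j
      simp only [hq, Pi.zero_apply, mul_eq_zero] at this
      exact this.resolve_left hs
    simp [hrow] at h11
  have hQ : (∑ i, Complex.normSq (q i)) ≠ 0 := fun h => hq0 ((sum_normSq_eq_zero_iff q).1 h)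
  -- assemble
  unfold archKappaAt
  rw [hP, trace_conjTranspose_vecMulVec_mul_mul, star_dotProduct_self_eq_ofReal, Complex.re_ofReal_mul]
  exact mul_ne_zero (intCast_sign_ne_zero (mul_ne_zero hQ hzre0)) (archMajoritySign_ne_zero L H' w)

end Place

/-! ## §3 Assembly: `Δ″_∞` is non-degenerate -/

section Main

variable (L : Type) [Field L] [NumberField L] [IsCMField L] (H' : Matrix (Fin 3) (Fin 3) L) (μ : HeckeCharacter L)
  (hl : ∀ (a : ↥(UnitaryGroup.arch (↥(maximalRealSubfield L)) L (IsCMField.complexConj L) 2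
          (Matrix.of fun i j : Fin 2 => if i.val + j.val + 1 = 2 then (1 : L) else 0)) ×
        ↥(UnitaryGroup.arch (↥(maximalRealSubfield L)) L (IsCMField.complexConj L) 1
          (Matrix.of fun i j : Fin 1 => if i.val + j.val + 1 = 1 then (1 : L) else 0)))
      (b : ↥(UnitaryGroup.arch (↥(maximalRealSubfield L)) L (IsCMField.complexConj L) 3 H'))
      (x : ↥(UnitaryGroup.arch (↥(maximalRealSubfield L)) L (IsCMField.complexConj L) 2
          (Matrix.of fun i j : Fin 2 => if i.val + j.val + 1 = 2 then (1 : L) else 0)) ×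
        ↥(UnitaryGroup.arch (↥(maximalRealSubfield L)) L (IsCMField.complexConj L) 1
          (Matrix.of fun i j : Fin 1 => if i.val + j.val + 1 = 1 then (1 : L) else 0))),
      archExplicitDelta L H' (x * a * x⁻¹) μ b = archExplicitDelta L H' a μ b)
  (hr : ∀ (a : ↥(UnitaryGroup.arch (↥(maximalRealSubfield L)) L (IsCMField.complexConj L) 2
          (Matrix.of fun i j : Fin 2 => if i.val + j.val + 1 = 2 then (1 : L) else 0)) ×
        ↥(UnitaryGroup.arch (↥(maximalRealSubfield L)) L (IsCMField.complexConj L) 1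
          (Matrix.of fun i j : Fin 1 => if i.val + j.val + 1 = 1 then (1 : L) else 0)))
      (b y : ↥(UnitaryGroup.arch (↥(maximalRealSubfield L)) L (IsCMField.complexConj L) 3 H')),
      archExplicitDelta L H' a μ (y * b * y⁻¹) = archExplicitDelta L H' a μ b)

open scoped Classical in
/-- **N2∞: PRINT'S FACTOR `Δ″_∞` IS NON-DEGENERATE** — `Δ″_∞(γ_H, γ′) ≠ 0` whenever `ι(γ_H) ↔ γ′` and `γ_H` is `G`-regular, for a `c`-hermitian anisotropic
`H′` (conjunct (iv) of ★ #77 `ArchTransfersExistCanonical` at `T := archExplicitTransferFactor L H′ μ hl hr`; typ-T6a's stub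
`stub_explicitFactor_nondegenerate` token for token; no hypothesis on `μ`). [cite: Rogawski1990, §4.9 pp. 54–55; §14.6 p. 242] [cite: LanglandsShelstad1987, §1] -/
theorem isArchNondegenerate_archExplicitTransferFactor (hherm : (H'.map (cmConjRingHom L)).transpose = H')
    (hanis : ∀ x : Fin 3 → L, hermForm (cmConjRingHom L) H' x x = 0 → x = 0) :
    IsArchNondegenerate L H' (archExplicitTransferFactor L H' μ hl hr) := by
  rw [isArchNondegenerate_iff]
  intro γH γ hp hreg
  rw [archExplicitTransferFactor_Δ, archExplicitDelta_of_isArchNormPair L H' γH μ hp]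
  refine mul_ne_zero (mul_ne_zero (archTau_ne_zero_of_isArchGRegular L γH μ hreg)
    (Complex.ofReal_ne_zero.2 (archWeylRatio_ne_zero_of_isArchGRegular L γH hreg))) ?_
  rw [Int.cast_ne_zero]
  exact Finset.prod_ne_zero_iff.2 fun w _ => archKappaAt_ne_zero L H' γH γ w hherm hanis hp hreg

/-- **N2∞ for the canonical factor `Δ‴_∞ = c(H′) · Δ″_∞`** (★ `archCanonicalTransferFactor`, `c(H′) = Π_w η_w(H′) = ±1`): non-degenerate on the matching
`G`-regular pairs for a `c`-hermitian anisotropic `H′` — the `hnd`∕(iv) input of the #77 pay-down lines at `T := Δ‴_∞`. [cite: Rogawski1990, §4.9 pp. 54–55; §14.6 p. 242] -/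
theorem isArchNondegenerate_archCanonicalTransferFactor (hherm : (H'.map (cmConjRingHom L)).transpose = H')
    (hanis : ∀ x : Fin 3 → L, hermForm (cmConjRingHom L) H' x x = 0 → x = 0) :
    IsArchNondegenerate L H' (archCanonicalTransferFactor L H' μ) := by
  rw [isArchNondegenerate_iff]
  intro γH γ hp hreg
  have h := (isArchNondegenerate_iff L H' _).1 (isArchNondegenerate_archExplicitTransferFactor L H' μ (archExplicitDelta_conj_left L H' μ)
    (archExplicitDelta_conj_right L H' μ) hherm hanis) γH γ hp hreg
  rw [archExplicitTransferFactor_Δ] at h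
  rw [archCanonicalTransferFactor_Δ]
  exact mul_ne_zero (archGlobalSign_cast_ne_zero L H') h

end Main

end Literature.NumberTheory.Rogawski1990

end
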